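import Summits.HubbardSuperconductivity.HubbardSuperconductivity.Theorems.CooperPairDMottWalkCooperPairDMottPlaquetteDWaveElement
import HarnessLib

/-!
# Crux `DressHalfFilled` (stmt-HubbardSuperconductivity-8148, route `LevyLogBootstrap`; shared with route
# `AnisotropyChord`): the torus pair field at side `2` is twice the plaquette `d`-wave pair operator; `c(U) > 0`

Support file (`--supports stmt-HubbardSuperconductivity-8148`) for STUB 1 `stub_plaquetteData` of the line
`Cruxes/DressHalfFilled/Lines/birth.lean` (verbatim `stub_kineticGlueInWindow` of `Cruxes/DressAnyFilling/Lines/birth.lean`,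
stmt-HubbardSuperconductivity-10291), clause (W2): the `B₁g` selection rule `0 < c(U)`,
`c(U) = (plaquettePairCouplings U).c = ‖⟨2h| Δ_d^{(R)} |0h⟩‖` (`PlaquettePairCouplings`), for `U ∈ [2, 4]`.

The tree certifies (`stub_plaquetteDWaveElement`, CooperPairDMott certified exact diagonalisation) that the TORUS
pair field `pairField dWaveFormFactor 2` of the `2 × 2` torus has a nonzero matrix element between every `(2,0)`
and every `(4,0)` sector ground state of the plaquette. The plaquette datum `c(U)` is built instead from the OPEN
plaquette operator `plaquetteDWavePair = Σ_{x,y} (g_d(y - x)/√2)(c_{x↑}c_{y↓} - c_{x↓}c_{y↑})` (no wrap-around).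
On the torus of side `2` the steps `+eᵢ` and `-eᵢ` lead to the same neighbour, so every bond is counted twice:

* `pairOp4_eq_sum_bondOp4` — in the computable `Fin 4` model, `pairOp4` (the torus pair field pulled back,
  `relabel_pairOp4`) is the combination `Σ_{a,b} (2 g_d(b - a)/√2) · bondOp4 a b` (the multiplicity `2` is the
  kernel-evaluated integer identity `pairOp4_coeff_eq`);
* `pairField_two_eq_two_smul_plaquetteDWavePair` — `pairField dWaveFormFactor 2 = 2 • plaquetteDWavePair`;
* `plaquette_c_pos` — hence `0 < c(U)` for `U ∈ [2, 4]` (W2).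

Sources: D. J. Scalapino, Phys. Rep. 250 (1995) 329, §2 (the `d_{x²-y²}` pair field); E. Altman, A. Auerbach,
PRB 65 (2002) 104508, §II.D (the plaquette pair creator); D. J. Scalapino, S. A. Trugman, Phil. Mag. B 74 (1996)
607 (`d`-wave symmetry of the operator connecting the `2`- and `4`-electron plaquette ground states). Bookkeeping
over tree definitions; no definition and no named fact is introduced.
-/

noncomputable section

set_option linter.dupNamespace false

namespace Summit.HubbardSuperconductivity.HubbardSuperconductivity.Theorems.LevyLogBootstrap

open Matrix Finset Literature.MathematicalPhysics.QuantumLattice Literature.Probability.LatticeModels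
open Summit.HubbardSuperconductivity.HubbardSuperconductivity.Theorems.CooperPairDMottWalk
open scoped ComplexOrder

/-- **The multiplicity two.** For every ordered pair of `Fin 4` sites, the total `d`-wave weight of the torus
steps `(x, e)`, `e ∈ {0, ±e₁, ±e₂}`, landing on it is TWICE the open-plaquette form factor `g_d(b - a)` (on the
torus of side `2`, `+eᵢ ≡ -eᵢ`). A finite check, evaluated by the kernel. [folklore] -/
theorem pairOp4_coeff_eq : ∀ a b : Fin 4,
    (∑ x : TorusSite 2 2, ∑ e ∈ insert (0 : Site 2) unitSteps,
        if site4 x = a ∧ site4 (x + Torus.proj 2 e) = b then dWaveInt e else 0) =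
      2 * dWaveInt (PlaquetteSite.step (siteEquiv a) (siteEquiv b)) := by
  decide +kernel

/-- **`pairOp4` on the sixteen bond operators**: `pairOp4 = Σ_{a,b} (1/√2)(2 g_d(b - a)) · bondOp4 a b`.
[folklore] -/
theorem pairOp4_eq_sum_bondOp4 :
    pairOp4 = ∑ a : Fin 4, ∑ b : Fin 4,
      (((1 / Real.sqrt 2 : ℝ) : ℂ) * ((2 * dWaveInt (PlaquetteSite.step (siteEquiv a) (siteEquiv b)) : ℤ) : ℂ)) •
        bondOp4 a b := by
  -- each torus term as an indicator combination of the sixteen bond operators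
  have key : ∀ (x : TorusSite 2 2) (e : Site 2),
      ((dWaveFormFactor e / Real.sqrt 2 : ℝ) : ℂ) • bondOp4 (site4 x) (site4 (x + Torus.proj 2 e)) =
        ∑ a : Fin 4, ∑ b : Fin 4,
          (((1 / Real.sqrt 2 : ℝ) : ℂ) *
              ((if site4 x = a ∧ site4 (x + Torus.proj 2 e) = b then dWaveInt e else 0 : ℤ) : ℂ)) •
            bondOp4 a b := by
    intro x e
    symm
    rw [Finset.sum_eq_single_of_mem (site4 x) (Finset.mem_univ _),
      Finset.sum_eq_single_of_mem (site4 (x + Torus.proj 2 e)) (Finset.mem_univ _)]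
    · rw [if_pos ⟨rfl, rfl⟩, dWave_coeff_eq]
    · intro b _ hb
      rw [if_neg (fun h => hb h.2.symm), Int.cast_zero, mul_zero, zero_smul]
    · intro a _ ha
      refine Finset.sum_eq_zero fun b _ => ?_
      rw [if_neg (fun h => ha h.1.symm), Int.cast_zero, mul_zero, zero_smul]
  calc pairOp4
      = ∑ x : TorusSite 2 2, ∑ e ∈ insert (0 : Site 2) unitSteps, ∑ a : Fin 4, ∑ b : Fin 4,
          (((1 / Real.sqrt 2 : ℝ) : ℂ) *
              ((if site4 x = a ∧ site4 (x + Torus.proj 2 e) = b then dWaveInt e else 0 : ℤ) : ℂ)) •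
            bondOp4 a b := by
        unfold pairOp4
        exact Finset.sum_congr rfl fun x _ => Finset.sum_congr rfl fun e _ => key x e
    _ = ∑ a : Fin 4, ∑ b : Fin 4, ∑ x : TorusSite 2 2, ∑ e ∈ insert (0 : Site 2) unitSteps,
          (((1 / Real.sqrt 2 : ℝ) : ℂ) *
              ((if site4 x = a ∧ site4 (x + Torus.proj 2 e) = b then dWaveInt e else 0 : ℤ) : ℂ)) •
            bondOp4 a b := sum_four_comm _ _
    _ = _ := by
        refine Finset.sum_congr rfl fun a _ => Finset.sum_congr rfl fun b _ => ?_
        simp only [← Finset.sum_smul, ← Finset.mul_sum]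
        rw [← pairOp4_coeff_eq a b]
        push_cast
        rfl

/-- **`Δ_d(torus, L = 2) = 2 · Δ_d^{(R)}(plaquette)`**: the torus pair field `pairField dWaveFormFactor 2` is
twice the open-plaquette `d`-wave pair operator `plaquetteDWavePair` (each plaquette bond is reached by the two
torus steps `±eᵢ`). [folklore] -/
theorem pairField_two_eq_two_smul_plaquetteDWavePair :
    pairField dWaveFormFactor 2 = (2 : ℂ) • plaquetteDWavePair := by
  rw [← relabel_pairOp4, pairOp4_eq_sum_bondOp4]
  simp only [relabel_sum, relabel_smul, bondOp4, relabel_sub, relabel_mul, relabel_annihilation,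
    orbEquiv, Orb.mapEquiv_orb]
  rw [plaquetteDWavePair, Finset.smul_sum]
  -- reindex the plaquette sums along `siteEquiv : Fin 4 ≃ PlaquetteSite`
  rw [← siteEquiv.sum_comp]
  refine Finset.sum_congr rfl fun a _ => ?_
  rw [Finset.smul_sum, ← siteEquiv.sum_comp]
  refine Finset.sum_congr rfl fun b _ => ?_
  rw [smul_smul, dWave_coeff_eq]
  push_cast
  ring_nf

/-- **(W2) The `B₁g` selection rule holds on `[2, 4]`: `0 < c(U)`.** The gauge-fixed overlap
`c(U) = ‖⟨2h| Δ_d^{(R)} |0h⟩‖` of the two plaquette states (`plaquettePairCouplings`) is positive: the tree's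
certified nonvanishing of `⟨φ₂, Δ_d(torus) φ₄⟩` for ALL `(2,0)`/`(4,0)` sector ground states
(`stub_plaquetteDWaveElement`), applied to `φ₂ = plaquettePair U`, `φ₄ = plaquetteVacuum U`, and
`Δ_d(torus) = 2 Δ_d^{(R)}`. Altman–Auerbach 2002 §II.D; Scalapino–Trugman 1996. [folklore] -/
theorem plaquette_c_pos {U : ℝ} (hU : U ∈ Set.Icc (2 : ℝ) 4) : 0 < (plaquettePairCouplings U).c := by
  have hne := (stub_plaquetteDWaveElement U hU).2 (plaquettePair U) (plaquetteVacuum U)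
    (plaquettePair_spec U).2 (plaquetteVacuum_spec U).2
  rw [pairField_two_eq_two_smul_plaquetteDWavePair, Matrix.smul_mulVec, dotProduct_smul] at hne
  have h0 : plaquetteDWaveOverlap U ≠ 0 := by
    intro h
    apply hne
    rw [plaquetteDWaveOverlap] at h
    rw [h, smul_zero]
  show 0 < ‖plaquetteDWaveOverlap U‖
  exact norm_pos_iff.2 h0

/-! ### Registered sub-goal of the crux item (stmt-HubbardSuperconductivity-8148) -/

set_option linter.style.longLine false in
/-- Registered sub-goal `dressHalfFilled_pairFieldTwo` of the crux item: `Δ_d(torus, L = 2) = 2 · Δ_d^{(R)}` (closed restatement of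
`pairField_two_eq_two_smul_plaquetteDWavePair`). [folklore] -/
theorem dressHalfFilled_pairFieldTwo : Literature.MathematicalPhysics.QuantumLattice.pairField Literature.MathematicalPhysics.QuantumLattice.dWaveFormFactor 2 = (2 : ℂ) • Literature.MathematicalPhysics.QuantumLattice.plaquetteDWavePair :=
  pairField_two_eq_two_smul_plaquetteDWavePair

end Summit.HubbardSuperconductivity.HubbardSuperconductivity.Theorems.LevyLogBootstrap

end
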